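import Summits.ResolutionOfSingularities.ResolutionOfSingularities.Theorems.FrobeniusClosingSteerWords17ALandedLeaves
import Summits.ResolutionOfSingularities.ResolutionOfSingularities.Theorems.FrobeniusClosingSteerOrderInductionWords
import Summits.ResolutionOfSingularities.ResolutionOfSingularities.Theorems.FrobeniusClosingSteerNormalStartReach
import Summits.ResolutionOfSingularities.ResolutionOfSingularities.Theorems.FrobeniusClosingSteerNormalStart
import Summits.ResolutionOfSingularities.ResolutionOfSingularities.Theorems.FrobeniusClosingSteerTamedMixedBranchReduction
import Summits.ResolutionOfSingularities.ResolutionOfSingularities.Theorems.FrobeniusClosingSteerHironakaLUIsolatedBranchOfCP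
import Literature.AlgebraicGeometry.Resolution.ArithmeticalThreefoldsLocalPermissible
import Literature.AlgebraicGeometry.Resolution.LipmanValuativeQuadraticSequence

/-!
# Crux `Steer` (stmt-ResolutionOfSingularities-16345), line `switching-dichotomy` — WORDS 17B: §σ2.20 (N0)+(N2) NORMALISED START leaves (`NormalAtGeneratorTwo`, `normalisedStartTwo_of_normalAtGenerator`, `normalAtGeneratorTwo_holds`, `normalisedStartTwo_holds`), §σ2.33 NSʳ LEAF (`normalisedStartReachTwo_of_normalAtGenerator`, `normalisedStartReachTwo_holds` — res-D-pv-003, r46), §σ2.24 THREADING OF RECORD (`noEternalIsolatedRadicandChain_three_of_CP'`, the `eternalSteeredRunTwo_of_slate*` compositions, `tamedMixedBranchReduction_holds`, the LOW corollaries `lowOrderTailConclTwoN_of_pieces'` / `…''` / `lowRunTamedMixedBranchTwo_holds` / `lowOrderTailConclTwoN_of_lipmanValuative`) (HOIST of the registered skeleton r47 be115170e44aee7c = l.460–679 of its W16A/W16B/W17A-swapped form r48)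

Holder res-L0-w41-lead-1 g6 on res-L0-w41-plan-1 RULING 47 (E1) / 104b; see `…Words01Core` for the hoist protocol (bodies byte for byte;
`[cite: …]` / `[folklore]` tags on CLOSED `def … : Prop` words are written «(ref. …)» / «(folklore)» — GATE NOTE of `…Words02Stubs`;
cite keys inside `[cite:]` tags normalised to `references.bib` keys where needed, as in `…Words03Phases`).
Nothing here is a statement of the manuscript [claim: Hironaka2017, status: under-review]. OURS (candidates / vocabulary; AI review is
weaker than expert review).
-/

open Summit.ResolutionOfSingularities.ResolutionOfSingularities.Theses.FrobeniusClosing (IsolatedForcedTermination)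
open Literature.AlgebraicGeometry.Resolution (IsAbhyankarPlace FGOver exists_ringKrullDim_eq_and_trdeg_eq
  trdeg_eq_trdeg_of_isFractionRing locAtCentre IsQuadraticTransformAlong SubringDominates IsRsopPart
  LocalUniformization3 RelLocalUniformization CossartPiltant2019General)
open Summit.ResolutionOfSingularities.ResolutionOfSingularities.Theorems.SteerRankThinness
  (HasProperCoarsening concl_of_hasProperCoarsening rankOne_of_not_hasProperCoarsening)
open Summit.ResolutionOfSingularities.ResolutionOfSingularities.Theorems.PfaffLine

set_option linter.dupNamespace false

namespace Summit.ResolutionOfSingularities.ResolutionOfSingularities.Theorems.SwitchingDichotomy.Words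

/-! ## §σ2.20 (N0)+(N2) NEED NO NEW TREE FILE (res-D-pv-028 g6, certification): `NormalisedStartTwo` ⇐ the pure (N1) statement
«a NormalAt generator exists in the FIXED ring `locAtCentre A₀ O`», by res-D-pv-028's LANDED B′ engine `SteeredRebase.rebase_of_model`
(p502870) at `A₁ := A₀`, `S := locAtCentre A₀ O`, `w := t₁` (model rows + push-down of `Concl`) and the in-skeleton landed-range
cascade `concl_or_coreDatum` (ALL fourteen core rows for `(A', t₁)` or `Concl` — no row transport). -/

/-- **(N1) as a Prop** — the ONE input of `NormalisedStartTwo` (res-D-pv-007 AS stub-5's `exists_normalAt_generator`, suggested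
VERBATIM target): from a core datum at `p = 2`, a generator `t₁` of the torsor over the fixed ring `S := locAtCentre A₀ O`
(`t = h · t₁ + g`, `g, h ∈ S`, `t₁ ^ p ∈ S`) with NO square carrier of positive value (`NormalAt O S p t₁`). OURS. (folklore) -/
def NormalAtGeneratorTwo : Prop :=
  ∀ p : ℕ, p = 2 →
    ∀ (k K : Type) [Field k] [CharP k p] [PerfectField k] [Field K] [Algebra k K]
    (O : ValuationSubring K) (A₀ : Subalgebra k K) (h₀ : A₀.toSubring ≤ O.toSubring) (t : K),
    CoreDatum p 4 k K O A₀ h₀ t →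
      ∃ t₁ g h : K, g ∈ locAtCentre A₀.toSubring O ∧ h ∈ locAtCentre A₀.toSubring O ∧ t = h * t₁ + g ∧
        t₁ ^ p ∈ locAtCentre A₀.toSubring O ∧ NormalAt O (locAtCentre A₀.toSubring O) p t₁

/-- **`NormalisedStartTwo` ⇐ (N1)** — (N0) and (N2) of RULING 7 DISCHARGED IN-SKELETON: re-base the datum at the normalised generator
`t₁` over the SAME local ring (`SteeredRebase.rebase_of_model`, p502870, with `A₁ := A₀`), then `concl_or_coreDatum` sorts `(A', t₁)` into
`Concl` (pushed down to `(A₀, t)` by the re-base) or a full core datum; `NormalAt` transports along `locAtCentre A' O = locAtCentre A₀ O`.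
Kernel-checked, no `sorry` of its own. OURS. [folklore] -/
theorem normalisedStartTwo_of_normalAtGenerator (hN1 : NormalAtGeneratorTwo) : NormalisedStartTwo := by
  intro p hp2 k K _i1 _i2 _i3 _i4 _i5 O A₀ h₀ t core
  have hp : p.Prime := hp2 ▸ Nat.prime_two
  obtain ⟨t₁, g, h, hg, hh, ht, ht₁, hN⟩ := hN1 p hp2 k K O A₀ h₀ t core
  obtain ⟨hfg, htp, hfr, hreg, -, hzd, -, -, -, -, -, -, htr, -⟩ := core
  have hregS : IsRegularLocalRing (locAtCentre A₀.toSubring O) :=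
    (Literature.AlgebraicGeometry.Resolution.isRegularLocalRing_locAtCentre_iff h₀).mpr hreg
  have htcl : t ∈ Subring.closure (insert t₁ (locAtCentre A₀.toSubring O : Set K)) := by
    rw [ht]
    exact Subring.add_mem _ (Subring.mul_mem _ (Subring.subset_closure (Set.mem_insert_of_mem _ hh))
      (Subring.subset_closure (Set.mem_insert _ _))) (Subring.subset_closure (Set.mem_insert_of_mem _ hg))
  obtain ⟨A', h', hle, hS', hfg', ht₁', -, hfr', hreg', hpush⟩ :=
    _root_.Summit.ResolutionOfSingularities.ResolutionOfSingularities.Theorems.SwitchingDichotomy.SteeredRebase.rebase_of_model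
      O A₀ A₀ h₀ le_rfl hfg (locAtCentre A₀.toSubring O) rfl t t₁ p hfr ht₁ htcl hregS
  rcases concl_or_coreDatum p hp 4 k K O A' h' t₁ htr hzd hfg' ht₁' hfr' hreg' with hC | core'
  · exact Or.inl (hpush hC)
  · refine Or.inr ⟨A', h', t₁, core', ?_, fun hC => hpush hC⟩
    rw [hS']
    exact hN

/-- **(N1) holds** (adoption leaf over res-D-pv-007 AS stub-5's LANDED p514532 `NormalStart.exists_normalAt_generator`: in the fixed F-finite
regular local ring a NormalAt generator exists — ACC on Jacobian ideals, Kunz). OURS. [cite: Matsumura1987, Thm. 26.5] [folklore] -/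
theorem normalAtGeneratorTwo_holds : NormalAtGeneratorTwo := by
  intro p hp2 k K _ _ _ _ _ O A₀ h₀ t core
  have hp : p.Prime := hp2 ▸ Nat.prime_two
  obtain ⟨hfg, htp, -, hreg, -, -, -, -, -, -, -, hc, -, -⟩ := core
  exact _root_.Summit.ResolutionOfSingularities.ResolutionOfSingularities.Theorems.SwitchingDichotomy.NormalStart.exists_normalAt_generator
    p hp O A₀ h₀ t hfg htp hreg hc

/-- **`NormalisedStartTwo` holds** ((N1) leaf + res-D-pv-028's glue). OURS. [folklore] -/
theorem normalisedStartTwo_holds : NormalisedStartTwo := normalisedStartTwo_of_normalAtGenerator normalAtGeneratorTwo_holds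

/-! ## §σ2.33 NSʳ LEAF (res-D-pv-003 g6, RULING 170b N-REACH): `NormalisedStartReachTwo` ⇐ (N1) — r45's
`normalisedStartTwo_of_normalAtGenerator` VERBATIM plus the reach clause, discharged by the TREE lemma
`NormalStart.cleanerReaches_body_of_rebase` (p543475) along `locAtCentre A'.toSubring O = locAtCentre A₀.toSubring O`
(`SteeredRebase.rebase_of_model` at `A₁ := A₀`) and `t = h · t₁ + g`. Kernel-checked, no `sorry` of its own. OURS. -/

/-- **`NormalisedStartReachTwo` ⇐ (N1)**: the normalised datum over the SAME local ring reaches no new cleaned order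
(`t ^ p − (h g₁ + g) ^ p = h ^ p (t₁ ^ p − g₁ ^ p)`). Kernel-checked. OURS. [folklore] -/
theorem normalisedStartReachTwo_of_normalAtGenerator (hN1 : NormalAtGeneratorTwo) :
    OrderInduction.NormalisedStartReachTwo := by
  intro p hp2 k K _i1 _i2 _i3 _i4 _i5 O A₀ h₀ t core
  have hp : p.Prime := hp2 ▸ Nat.prime_two
  haveI : Fact p.Prime := ⟨hp⟩
  haveI : CharP K p := charP_of_injective_algebraMap (algebraMap k K).injective p
  obtain ⟨t₁, g, h, hg, hh, ht, ht₁, hN⟩ := hN1 p hp2 k K O A₀ h₀ t core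
  obtain ⟨hfg, htp, hfr, hreg, -, hzd, -, -, -, -, -, -, htr, -⟩ := core
  have hregS : IsRegularLocalRing (locAtCentre A₀.toSubring O) :=
    (Literature.AlgebraicGeometry.Resolution.isRegularLocalRing_locAtCentre_iff h₀).mpr hreg
  have htcl : t ∈ Subring.closure (insert t₁ (locAtCentre A₀.toSubring O : Set K)) := by
    rw [ht]
    exact Subring.add_mem _ (Subring.mul_mem _ (Subring.subset_closure (Set.mem_insert_of_mem _ hh))
      (Subring.subset_closure (Set.mem_insert _ _))) (Subring.subset_closure (Set.mem_insert_of_mem _ hg))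
  obtain ⟨A', h', hle, hS', hfg', ht₁', -, hfr', hreg', hpush⟩ :=
    _root_.Summit.ResolutionOfSingularities.ResolutionOfSingularities.Theorems.SwitchingDichotomy.SteeredRebase.rebase_of_model
      O A₀ A₀ h₀ le_rfl hfg (locAtCentre A₀.toSubring O) rfl t t₁ p hfr ht₁ htcl hregS
  have hreach : ∀ d : ℕ, OrderInduction.CleanerReaches p O A'.toSubring t₁ d →
      OrderInduction.CleanerReaches p O A₀.toSubring t d := fun d hd =>
    _root_.Summit.ResolutionOfSingularities.ResolutionOfSingularities.Theorems.SwitchingDichotomy.NormalStart.cleanerReaches_body_of_rebase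
      p O hS' hg hh ht (d := d) hd
  rcases concl_or_coreDatum p hp 4 k K O A' h' t₁ htr hzd hfg' ht₁' hfr' hreg' with hC | core'
  · exact Or.inl (hpush hC)
  · refine Or.inr ⟨A', h', t₁, core', ?_, fun hC => hpush hC, hreach⟩
    rw [hS']
    exact hN

/-- **`NormalisedStartReachTwo` holds** ((N1) leaf `normalAtGeneratorTwo_holds` + the reach clause). OURS. [folklore] -/
theorem normalisedStartReachTwo_holds : OrderInduction.NormalisedStartReachTwo :=
  normalisedStartReachTwo_of_normalAtGenerator normalAtGeneratorTwo_holds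


/-! ### §σ2.24 (holder res-L0-w41-lead-1 g4, r27) — THREADING OF RECORD (plan-1 RULINGS 17d / 18b / 22a (iii)): the CP debt in its
PRINTED SHAPE (`CossartPiltant2019LocalPermissible`, res-type-026's p509714, via 026's LANDED bridge
`HironakaLUBranchOfCP.hironakaLUIsolatedBranch_of_localPermissible` p513630 → the branch form → K(3)), the LOW binder slot
`(hLV : Lipman1978ValuativeQuadraticSequence.{0})` (idea-3's §σ2.23 consumes it; until that delta lands LOW stays the single hypothesis
`hLow`), and B4 as the ONE remaining input of the HIGH point-tail piece. Pure logic. OURS. -/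

/-- K(3) modulo Cossart–Piltant 2019 in the PRINTED (normally-flat, permissible-tower) shape. OURS.
[cite: CossartPiltant2019, Thm. 1.5 (arXiv v1: Thm. 1.4)] -/
theorem noEternalIsolatedRadicandChain_three_of_CP' (hCP' : Literature.AlgebraicGeometry.Resolution.CossartPiltant2019LocalPermissible.{0}) :
    ∀ p : ℕ, p.Prime → NoEternalIsolatedRadicandChain p 3 :=
  noEternalIsolatedRadicandChain_three_of_CP
    (_root_.Summit.ResolutionOfSingularities.ResolutionOfSingularities.Theorems.SwitchingDichotomy.HironakaLUBranchOfCP.hironakaLUIsolatedBranch_of_localPermissible hCP')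

/-- **THE T-LINE OF RECORD (r27)**: T ⇐ (N1) `NormalAtGeneratorTwo` · B4 `NoHeightOneCarrierTwo` · T-i `FinitelyHitThreadTwoN` · Θ2
`HitHeightLtTwoN` · **BIRTHS `BirthWanderConclTwoN` ∧ BRANCHING `BranchWanderConclTwoN` (FRONTIER)** · LOWᴺ `LowOrderTailConclTwoN` (with the
valuative Lipman slot `hLV` reserved for §σ2.23) · the named facts Lipman 1978 (branch form, K(2)/THREAD), Lipman 1978 (valuative form, LOW)
and Cossart–Piltant 2019 Thm 1.5 (printed shape). Pure logic over the in-file leaves. OURS. [folklore] -/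
theorem eternalSteeredRunTwo_of_slate (hN1 : NormalAtGeneratorTwo) (hB4 : NoHeightOneCarrierTwo)
    (hTi : FinitelyHitThreadTwoN) (hH : HitHeightLtTwoN) (hB : BirthWanderConclTwoN) (hC : BranchWanderConclTwoN)
    (hLow : Literature.AlgebraicGeometry.Resolution.Lipman1978ValuativeQuadraticSequence.{0} → LowOrderTailConclTwoN)
    (hL : Literature.AlgebraicGeometry.Resolution.Lipman1978NoEternalNormalBranch.{0})
    (hLV : Literature.AlgebraicGeometry.Resolution.Lipman1978ValuativeQuadraticSequence.{0})
    (hCP' : Literature.AlgebraicGeometry.Resolution.CossartPiltant2019LocalPermissible.{0}) : EternalSteeredRunTwo :=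
  eternalSteeredRunTwo_of_normalised_thread_debts (normalisedStartTwo_of_normalAtGenerator hN1)
    (pointTailHighConclTwo_of_B4 hB4) hTi hH hB hC (hLow hLV) hL
    (_root_.Summit.ResolutionOfSingularities.ResolutionOfSingularities.Theorems.SwitchingDichotomy.HironakaLUBranchOfCP.hironakaLUIsolatedBranch_of_localPermissible hCP')

/-- **THE T-LINE OF RECORD (r28)** — (N1) DISCHARGED: T ⇐ B4 · T-i · Θ2 · BIRTHS ∧ BRANCHING (FRONTIER) · LOWᴺ (⇐ hLV) · the named facts.
OURS. [folklore] -/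
theorem eternalSteeredRunTwo_of_slate' (hB4 : NoHeightOneCarrierTwo)
    (hTi : FinitelyHitThreadTwoN) (hH : HitHeightLtTwoN) (hB : BirthWanderConclTwoN) (hC : BranchWanderConclTwoN)
    (hLow : Literature.AlgebraicGeometry.Resolution.Lipman1978ValuativeQuadraticSequence.{0} → LowOrderTailConclTwoN)
    (hL : Literature.AlgebraicGeometry.Resolution.Lipman1978NoEternalNormalBranch.{0})
    (hLV : Literature.AlgebraicGeometry.Resolution.Lipman1978ValuativeQuadraticSequence.{0})
    (hCP' : Literature.AlgebraicGeometry.Resolution.CossartPiltant2019LocalPermissible.{0}) : EternalSteeredRunTwo :=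
  eternalSteeredRunTwo_of_slate normalAtGeneratorTwo_holds hB4 hTi hH hB hC hLow hL hLV hCP'

-- ========================= PART B (after `eternalSteeredRunTwo_of_slate`) =========================
/-- **§σ2.23 slate instance** (PROVED; res-L0-w41-strat-2): r27's whole p = 2 T-line `eternalSteeredRunTwo_of_slate` with the `hLow` slot
filled by the LOW assembly — open hypotheses after this fold: `NormalAtGeneratorTwo` (pv-007 leaf on p514532), B4 (096 leaf on p513726), T-i
(pv-011), Θ2 (072/071), FRONTIER {`BirthWanderConclTwoN`, `BranchWanderConclTwoN`}, `step` (pv-028 `lowOrder_step_two`), D3 (pv-012 / pv-007 /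
062 / stub-3 via §σ2.24), 026's reduction, and the named facts (Lipman branch + valuative, CP2019 local permissible). Pure logic. OURS. [folklore] -/
theorem eternalSteeredRunTwo_of_slate_low (hN1 : NormalAtGeneratorTwo) (hB4 : NoHeightOneCarrierTwo)
    (hTi : FinitelyHitThreadTwoN) (hH : HitHeightLtTwoN) (hB : BirthWanderConclTwoN) (hC : BranchWanderConclTwoN)
    (step : ∀ p : ℕ, p = 2 →
      ∀ (k K : Type) [Field k] [CharP k p] [PerfectField k] [Field K] [Algebra k K]
      (O : ValuationSubring K) (A₀ : Subalgebra k K) (h₀ : A₀.toSubring ≤ O.toSubring) (t : K),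
      CoreDatum p 4 k K O A₀ h₀ t →
      ∀ (R : ℕ → Subring K) (P : (i : ℕ) → Ideal (R i)) (s : ℕ → K),
        R 0 = locAtCentre A₀.toSubring O → IsSteeredRun O R P t p s →
        ∀ i, ¬ IsHighOrderAt R s p i → ¬ IsHighOrderAt R s p (i + 1))
    (hD3 : LowRunTamedMixedBranchTwo)
    (hRed : Literature.AlgebraicGeometry.Resolution.Lipman1978ValuativeQuadraticSequence.{0} → NoEternalTamedMixedBranch)
    (hL : Literature.AlgebraicGeometry.Resolution.Lipman1978NoEternalNormalBranch.{0})
    (hLV : Literature.AlgebraicGeometry.Resolution.Lipman1978ValuativeQuadraticSequence.{0})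
    (hCP' : Literature.AlgebraicGeometry.Resolution.CossartPiltant2019LocalPermissible.{0}) : EternalSteeredRunTwo :=
  eternalSteeredRunTwo_of_slate hN1 hB4 hTi hH hB hC (lowOrderTailConclTwoN_of_lipman step hD3 hRed) hL hLV hCP'

/-- **026's reduction holds**: `NoEternalTamedMixedBranch` from the valuative Lipman fact (adoption leaf over res-type-026's LANDED
`TamedMixedBranch.tamedMixedBranchReduction`, `…SteerTamedMixedBranchReduction`; 026's certified text 09:02:39Z). OURS. [folklore] -/
theorem tamedMixedBranchReduction_holds (hLV : Literature.AlgebraicGeometry.Resolution.Lipman1978ValuativeQuadraticSequence.{0}) :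
    NoEternalTamedMixedBranch :=
  fun k _K _ _ _ Y htr hY hT =>
    _root_.Summit.ResolutionOfSingularities.ResolutionOfSingularities.Theorems.SwitchingDichotomy.TamedMixedBranch.tamedMixedBranchReduction
      hLV k Y htr hY hT.1 hT.2.1 hT.2.2

/-- **LOWᴺ ON THE RECORD modulo C8 · D3a · D3b′ · D3c · D3d · Lipman (valuative)** (r31: `step` := stub-2's `lowOrderStep_holds`, duals, B7 and
026's reduction discharged). Pure logic. OURS. [folklore] -/
theorem lowOrderTailConclTwoN_of_pieces' (hC8 : LowSurfaceStepExitsTwo) (hD3a : LowTowerExistsTwo)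
    (hD3b : LowTowerPointStepsIOTwo) (hD3c : LowTowerTamingTwo) (hD3d : LowTowerSingularTwo)
    (hLV : Literature.AlgebraicGeometry.Resolution.Lipman1978ValuativeQuadraticSequence.{0}) : LowOrderTailConclTwoN :=
  lowOrderTailConclTwoN_of_pieces lowOrderStep_holds membersDualDerivationsTwoN_holds rankFourExitTwo_holds hC8 hD3a hD3b hD3c hD3d
    (tamedMixedBranchReduction_holds hLV)

/-- **LOWᴺ ON THE RECORD modulo D3a · D3c · Lipman (valuative)** (r32). Pure logic. OURS. [folklore] -/
theorem lowOrderTailConclTwoN_of_pieces'' (hD3a : LowTowerExistsTwo) (hD3c : LowTowerTamingTwo)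
    (hLV : Literature.AlgebraicGeometry.Resolution.Lipman1978ValuativeQuadraticSequence.{0}) : LowOrderTailConclTwoN :=
  lowOrderTailConclTwoN_of_pieces' lowSurfaceStepExitsTwo_holds hD3a lowTowerPointStepsIOTwo_holds hD3c
    lowTowerSingularTwo_holds hLV

/-- **D3 · `LowRunTamedMixedBranchTwo` HOLDS — every piece a leaf** (C8 res-type-072 · D3a res-L0-w41-stub-3 over res-D-pv-012 / res-type-096 ·
D3b′ res-D-pv-007 · D3c res-type-062 · D3d res-L0-w41-stub-3). Pure logic. OURS. [folklore] -/
theorem lowRunTamedMixedBranchTwo_holds : LowRunTamedMixedBranchTwo :=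
  lowRunTamedMixedBranchTwo_of_pieces'' lowTowerExistsTwo_holds lowTowerTamingTwo_holds

/-- **LOWᴺ ON THE RECORD modulo Lipman 1978 (valuative) ONLY** (all five LOW pieces leaves). Pure logic. OURS. [folklore] -/
theorem lowOrderTailConclTwoN_of_lipmanValuative
    (hLV : Literature.AlgebraicGeometry.Resolution.Lipman1978ValuativeQuadraticSequence.{0}) : LowOrderTailConclTwoN :=
  lowOrderTailConclTwoN_of_pieces'' lowTowerExistsTwo_holds lowTowerTamingTwo_holds hLV




/-- **THE T-LINE OF RECORD (r29)** — (N1) and 026's reduction DISCHARGED, LOW unfolded into its pieces: T ⇐ B4 · T-i · Θ2 · BIRTHS ∧ BRANCHING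
(FRONTIER) · `step` (tri-2's `lowOrder_step_two`, pv-028) · D3 `LowRunTamedMixedBranchTwo` (the LOW tower: pv-012 D3a / pv-007 D3b / 062 D3c /
stub-3 D3d + 072 C8) · the named facts. OURS. [folklore] -/
theorem eternalSteeredRunTwo_of_slate_low' (hB4 : NoHeightOneCarrierTwo)
    (hTi : FinitelyHitThreadTwoN) (hH : HitHeightLtTwoN) (hB : BirthWanderConclTwoN) (hC : BranchWanderConclTwoN)
    (step : ∀ p : ℕ, p = 2 →
      ∀ (k K : Type) [Field k] [CharP k p] [PerfectField k] [Field K] [Algebra k K]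
      (O : ValuationSubring K) (A₀ : Subalgebra k K) (h₀ : A₀.toSubring ≤ O.toSubring) (t : K),
      CoreDatum p 4 k K O A₀ h₀ t →
      ∀ (R : ℕ → Subring K) (P : (i : ℕ) → Ideal (R i)) (s : ℕ → K),
        R 0 = locAtCentre A₀.toSubring O → IsSteeredRun O R P t p s →
        ∀ i, ¬ IsHighOrderAt R s p i → ¬ IsHighOrderAt R s p (i + 1))
    (hD3 : LowRunTamedMixedBranchTwo)
    (hL : Literature.AlgebraicGeometry.Resolution.Lipman1978NoEternalNormalBranch.{0})
    (hLV : Literature.AlgebraicGeometry.Resolution.Lipman1978ValuativeQuadraticSequence.{0})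
    (hCP' : Literature.AlgebraicGeometry.Resolution.CossartPiltant2019LocalPermissible.{0}) : EternalSteeredRunTwo :=
  eternalSteeredRunTwo_of_slate_low normalAtGeneratorTwo_holds hB4 hTi hH hB hC step hD3 tamedMixedBranchReduction_holds hL hLV hCP'

/-- **THE T-LINE OF RECORD (r30)** — PT₁ ∩ HIGH, (N1) and 026's reduction all DISCHARGED: T ⇐ T-i `FinitelyHitThreadTwoN` · Θ2 `HitHeightLtTwoN` ·
**BIRTHS ∧ BRANCHING (FRONTIER)** · `step` (`lowOrder_step_two`) · D3 `LowRunTamedMixedBranchTwo` · the named facts Lipman 1978 (branch + valuative)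
and Cossart–Piltant 2019 (printed shape). OURS. [folklore] -/
theorem eternalSteeredRunTwo_of_slate_low'' (hTi : FinitelyHitThreadTwoN) (hH : HitHeightLtTwoN)
    (hB : BirthWanderConclTwoN) (hC : BranchWanderConclTwoN)
    (step : ∀ p : ℕ, p = 2 →
      ∀ (k K : Type) [Field k] [CharP k p] [PerfectField k] [Field K] [Algebra k K]
      (O : ValuationSubring K) (A₀ : Subalgebra k K) (h₀ : A₀.toSubring ≤ O.toSubring) (t : K),
      CoreDatum p 4 k K O A₀ h₀ t →
      ∀ (R : ℕ → Subring K) (P : (i : ℕ) → Ideal (R i)) (s : ℕ → K),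
        R 0 = locAtCentre A₀.toSubring O → IsSteeredRun O R P t p s →
        ∀ i, ¬ IsHighOrderAt R s p i → ¬ IsHighOrderAt R s p (i + 1))
    (hD3 : LowRunTamedMixedBranchTwo)
    (hL : Literature.AlgebraicGeometry.Resolution.Lipman1978NoEternalNormalBranch.{0})
    (hLV : Literature.AlgebraicGeometry.Resolution.Lipman1978ValuativeQuadraticSequence.{0})
    (hCP' : Literature.AlgebraicGeometry.Resolution.CossartPiltant2019LocalPermissible.{0}) : EternalSteeredRunTwo :=
  eternalSteeredRunTwo_of_slate_low' noHeightOneCarrierTwo_holds hTi hH hB hC step hD3 hL hLV hCP'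


end Summit.ResolutionOfSingularities.ResolutionOfSingularities.Theorems.SwitchingDichotomy.Words
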